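/-
Copyright (c) 2026. All rights reserved.
Released under Apache 2.0 license as described in the file LICENSE.
-/
import Mathlib.AlgebraicGeometry.Morphisms.QuasiSeparated
import Mathlib.AlgebraicGeometry.Noetherian
import Literature.AlgebraicGeometry.Motives.GeneratingSectionsOfLineBundle
import Literature.AlgebraicGeometry.Motives.QuasiProjectiveOfGeneratingSections
import HarnessLib

/-!
# Generating sections with affine non-vanishing loci from locally ample pieces

Layer `Literature/AlgebraicGeometry/Motives`; namespace `Literature.AlgebraicGeometry.Motives.GeneratingSections`.
THEOREMS ONLY (no definition, no named fact, no instance, no `sorry`).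

The situation (EGA II, remark after Thm. 4.5.2, as used in the proof of [MumfordFogartyKirwan1994, Ch. 3 §2
Thm. 3.8 (p. 77)]; Görtz–Wedhorn I, Prop. 13.47 / Lemma 13.48): on a Noetherian scheme `X` we are given

* a line bundle `𝓛` with finitely many global sections `s_i` — in the tree's COEFFICIENT currency a
  `CocycleSections ι W` datum `S` (`Motives/GeneratingSectionsOfCocycle`): the coefficients `S i a ∈ Γ(X, W a)` of
  `s_i` in a trivialisation on the opens `W a` —, with non-vanishing loci `U_i = X_{s_i} = ⋃_a X_{S i a}`;
* a second line bundle `𝓝`, given by transition units `g_{bb'}` on a cover `W' b`, and for every `i` finitely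
  many sections `t_{ik}` of `𝓝` OVER `U_i` ONLY — coefficients `T i k b ∈ Γ(X, W' b ∩ U_i)` with
  `T i k b' = g_{bb'} T i k b` — whose non-vanishing loci `(U_i)_{t_{ik}}` are AFFINE and, all together, cover `X`.

Conclusion (`exists_generatingSections_of_affinePieces`): there is a generating-sections datum on `X`
(`GeneratingSections (Σ i, κ i) X`, the chart form of a line bundle generated by finitely many global sections,
`Motives/MorphismsToProjectiveSpace`) whose opens are EXACTLY the affine pieces `(U_i)_{t_{ik}}` — informally, the
sections `t_{ik} · s_i^n` of `𝓝 ⊗ 𝓛^{⊗n}` for `n ≫ 0`.  Hence (`isQuasiProjectiveOver_of_affinePieces`) a scheme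
locally of finite type over a field carrying such data is quasi-projective
(★ `GeneratingSections.isQuasiProjectiveOver_of_isAffineOpen`).

The proof is Hartshorne II Lemma 5.14 / EGA I 9.3.1 run uniformly over finitely many charts: `t·s^n` extends from
`X_s` to the whole chart for `n ≫ 0` (Mathlib `exists_eq_pow_mul_of_isCompact_of_isQuasiSeparated`, every open of a
Noetherian scheme being quasi-compact and quasi-separated), and the cross-compatibilities of the extended
coefficients hold after one more uniform power of `s` (Mathlib `exists_of_res_eq_of_qcqs`).  No tensor product of
`𝒪_X`-modules is formed: products of sections are products of coefficient functions.

* `exists_generatingSections_of_affinePieces` — the core statement (coefficient form);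
* `exists_generatingSections_isAffineOpen_of_affinePieces` — the same with the conclusion «all opens affine»;
* `isQuasiProjectiveOver_of_affinePieces` — over a field, with `LocallyOfFiniteType`, the scheme is quasi-projective.

Consumer (cell `hodgecm-mathlib`, F-9 road Q2, count-neutral): `ModuliOfAbelianVarieties/SiegelModuliQuasiProjective`
(quasi-projectivity of the glued Siegel moduli scheme from its frame-slices).

## References

* A. Grothendieck, J. Dieudonné, *EGA II* (1961), Thm. 4.5.2 and the remark following it; *EGA I* (1960) 9.3.1. [EGAII]
* R. Hartshorne, *Algebraic Geometry*, GTM 52 (1977), II Lemma 5.14 (p. 118), II Thm. 7.6 (p. 159). [Hartshorne1977]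
* U. Görtz, T. Wedhorn, *Algebraic Geometry I*, 2nd ed. (2020), Prop. 13.47, Lemma 13.48 (pp. 392–393). [GortzWedhorn2020]
* D. Mumford, J. Fogarty, F. Kirwan, *Geometric Invariant Theory*, 3rd ed. (1994), Ch. 3 §2 Thm. 3.8 (p. 77). [MumfordFogartyKirwan1994]
-/

universe u v w

open CategoryTheory AlgebraicGeometry Opposite TopologicalSpace
open Literature.AlgebraicGeometry.HodgeTheory (IsQuasiProjectiveOver)

namespace Literature.AlgebraicGeometry.Motives

namespace GeneratingSections

namespace CocycleSections

variable {X : Scheme.{u}}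

/-! ### Restriction bookkeeping on `𝒪_X` -/

/-- Restricting twice is restricting once. [folklore] -/
private theorem res_res {U V V' : X.Opens} (h₁ : V ≤ U) (h₂ : V' ≤ V) (s : Γ(X, U)) :
    X.presheaf.map (homOfLE h₂).op (X.presheaf.map (homOfLE h₁).op s) =
      X.presheaf.map (homOfLE (h₂.trans h₁)).op s := by
  rw [← CommRingCat.comp_apply, ← Functor.map_comp]
  rfl

/-- Ring identity behind the cross-compatibility on the small opens. [folklore] -/
private theorem cross_algebra {R : Type*} [CommRing R] {A B C D γ Xp Wq : R} {n : ℕ} (h : A * B = C * D) :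
    A ^ n * (γ * Xp) * (B ^ n * Wq) = C ^ n * (γ * Wq) * (D ^ n * Xp) := by
  have hpow := congr_arg (fun z => z ^ n) h
  simp only [mul_pow] at hpow
  linear_combination (γ * Xp * Wq) * hpow

/-- Ring identity behind the torsion killing: from `s^N u = s^N v` with `s = (A B)(C D)` and `A B = C D` to the
cross identity with exponent `2N + 1`. [folklore] -/
private theorem cross_of_torsion {R : Type*} [CommRing R] {A B C D y₁ y₂ y₃ y₄ : R} {N : ℕ} (h : A * B = C * D)
    (ht : (A * B * (C * D)) ^ N * (y₁ * y₂) = (A * B * (C * D)) ^ N * (y₃ * y₄)) :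
    A ^ (2 * N + 1) * y₁ * (B ^ (2 * N + 1) * y₂) = C ^ (2 * N + 1) * y₃ * (D ^ (2 * N + 1) * y₄) := by
  have h2 : (A * B) ^ (2 * N) * (y₁ * y₂) = (A * B) ^ (2 * N) * (y₃ * y₄) := by
    have hs : A * B * (C * D) = (A * B) ^ 2 := by rw [← h]; ring
    rw [hs, ← pow_mul, mul_comm 2 N] at ht
    rw [mul_comm 2 N]
    exact ht
  calc A ^ (2 * N + 1) * y₁ * (B ^ (2 * N + 1) * y₂) = A * B * ((A * B) ^ (2 * N) * (y₁ * y₂)) := by ring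
    _ = A * B * ((A * B) ^ (2 * N) * (y₃ * y₄)) := by rw [h2]
    _ = C * D * ((C * D) ^ (2 * N) * (y₃ * y₄)) := by rw [h]
    _ = C ^ (2 * N + 1) * y₃ * (D ^ (2 * N + 1) * y₄) := by ring

/-! ### Hartshorne II 5.14 uniformly over finitely many charts (Noetherian `X`) -/

section Noetherian

variable [IsNoetherian X]

/-- Every open of a Noetherian scheme is quasi-compact. [folklore] -/
private theorem isCompact_carrier (U : X.Opens) : IsCompact U.1 :=
  NoetherianSpace.isCompact _

/-- Every open of a Noetherian scheme is quasi-separated. [folklore] -/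
private theorem isQuasiSeparated_carrier (U : X.Opens) : IsQuasiSeparated U.1 :=
  IsQuasiSeparated.of_quasiSeparatedSpace _

/-- **Uniform extension of sections** (Hartshorne II Lemma 5.14 (b), finitely many charts at once): for opens
`V p`, functions `f p` on `V p` and `x p` on `X_{f p}`, there are ONE exponent `n` and functions `y p` on `V p`
with `y p |_{X_{f p}} = f p ^ n · x p`. [cite: Hartshorne1977, II Lemma 5.14 (p. 118)] -/
theorem exists_uniform_extension {P : Type*} [Finite P] (V : P → X.Opens)
    (f : ∀ p, Γ(X, V p)) (x : ∀ p, Γ(X, X.basicOpen (f p))) :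
    ∃ (n : ℕ) (y : ∀ p, Γ(X, V p)), ∀ p,
      X.presheaf.map (homOfLE (X.basicOpen_le (f p))).op (y p) =
        X.presheaf.map (homOfLE (X.basicOpen_le (f p))).op (f p) ^ n * x p := by
  classical
  have h := fun p => exists_eq_pow_mul_of_isCompact_of_isQuasiSeparated X (V p)
    (isCompact_carrier (V p)) (isQuasiSeparated_carrier (V p)) (f p) (x p)
  choose n y hy using h
  cases nonempty_fintype P
  refine ⟨Finset.univ.sup n, fun p => f p ^ (Finset.univ.sup n - n p) * y p, fun p => ?_⟩
  have hle : n p ≤ Finset.univ.sup n := Finset.le_sup (Finset.mem_univ p)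
  have hy' : X.presheaf.map (homOfLE (X.basicOpen_le (f p))).op (y p) =
      X.presheaf.map (homOfLE (X.basicOpen_le (f p))).op (f p) ^ n p * x p := hy p
  rw [map_mul, map_pow, hy', ← mul_assoc, ← pow_add, Nat.sub_add_cancel hle]

/-- **Uniform torsion**: functions `u p`, `v p` on opens `V p` which agree on `X_{s p}` become equal after
multiplication by ONE power of the `s p` (the injectivity half of `Γ(X_s) = Γ(V)_s`, Hartshorne II Lemma 5.14 (a)).
[cite: Hartshorne1977, II Lemma 5.14 (p. 118)] -/
theorem exists_uniform_pow_mul_eq {P : Type*} [Finite P] (V : P → X.Opens) (s u v : ∀ p, Γ(X, V p))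
    (h : ∀ p, X.presheaf.map (homOfLE (X.basicOpen_le (s p))).op (u p) =
      X.presheaf.map (homOfLE (X.basicOpen_le (s p))).op (v p)) :
    ∃ N : ℕ, ∀ p, s p ^ N * u p = s p ^ N * v p := by
  classical
  have h' : ∀ p, ∃ n : ℕ, s p ^ n * u p = s p ^ n * v p := fun p =>
    exists_of_res_eq_of_qcqs (isCompact_carrier (V p)) (isQuasiSeparated_carrier (V p)) (h p)
  choose n hn using h'
  cases nonempty_fintype P
  refine ⟨Finset.univ.sup n, fun p => ?_⟩
  have hle : n p ≤ Finset.univ.sup n := Finset.le_sup (Finset.mem_univ p)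
  rw [← Nat.sub_add_cancel hle, pow_add, mul_assoc, mul_assoc, hn p]

/-- **Finite sub-cover by indices**: on a quasi-compact scheme a family of opens with `⨆ = ⊤` has a finite
sub-family with `⨆ = ⊤`. [folklore] -/
private theorem exists_finset_iSup_eq_top {γ : Type*} (O : γ → X.Opens) (hO : ⨆ c, O c = ⊤) :
    ∃ s : Finset γ, ⨆ c ∈ s, O c = ⊤ := by
  have hc : IsCompactElement (⊤ : X.Opens) := (Opens.isCompactElement_iff ⊤).mpr isCompact_univ
  obtain ⟨s, hs⟩ := CompleteLattice.IsCompactElement.exists_finset_of_le_iSup (hk := hc) (f := O) (h := hO.ge)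
  exact ⟨s, top_le_iff.mp hs⟩

end Noetherian

/-! ### The theorem -/

section Main

variable [IsNoetherian X] {α : Type v} {β : Type w} {W : α → X.Opens} (W' : β → X.Opens)
  {ι : Type} [Finite ι] (S : CocycleSections ι W)
  (g : (b b' : β) → Γ(X, W' b ⊓ W' b')) (hg : ∀ b b', IsUnit (g b b'))
  {κ : ι → Type} [∀ i, Finite (κ i)]
  (T : ∀ i, κ i → ∀ b : β, Γ(X, W' b ⊓ ⨆ a, X.basicOpen (S.coeff i a)))
  (hT : ∀ i (k : κ i) (b b' : β),
    X.presheaf.map (homOfLE (inf_le_right :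
        (W' b ⊓ ⨆ a, X.basicOpen (S.coeff i a)) ⊓ (W' b' ⊓ ⨆ a, X.basicOpen (S.coeff i a)) ≤ _)).op
        (T i k b') =
      X.presheaf.map (homOfLE (inf_le_inf inf_le_left inf_le_left :
        (W' b ⊓ ⨆ a, X.basicOpen (S.coeff i a)) ⊓ (W' b' ⊓ ⨆ a, X.basicOpen (S.coeff i a)) ≤
          W' b ⊓ W' b')).op (g b b') *
      X.presheaf.map (homOfLE (inf_le_left :
        (W' b ⊓ ⨆ a, X.basicOpen (S.coeff i a)) ⊓ (W' b' ⊓ ⨆ a, X.basicOpen (S.coeff i a)) ≤ _)).op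
        (T i k b))
  (haff : ∀ i k, IsAffineOpen (⨆ b, X.basicOpen (T i k b)))
  (hcov : ⨆ i, ⨆ k, ⨆ b, X.basicOpen (T i k b) = ⊤)

include hg hT hcov in
/-- **Generating sections from locally ample pieces** (EGA II, remark after Thm. 4.5.2, in the form used in the
proof of [MumfordFogartyKirwan1994, Ch. 3 §2 Thm. 3.8]; Görtz–Wedhorn I, Prop. 13.47 / Lemma 13.48): let `𝓛` be a
line bundle on the Noetherian scheme `X` with finitely many global sections `s_i` — in coefficients, `S` on the cover
`W` — and `U_i = X_{s_i}`; let `𝓝` be a second line bundle — transition units `g` on the cover `W'` — and for every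
`i` let `t_{ik}` be finitely many sections of `𝓝` over `U_i` — coefficients `T i k b` on `W' b ∩ U_i` with
`T i k b' = g_{bb'} · T i k b` — whose non-vanishing loci `(U_i)_{t_{ik}}` together cover `X`.  Then the sections
`t_{ik} · s_i^n` (`n ≫ 0`) of `𝓝 ⊗ 𝓛^{⊗ n}` form generating-sections data on `X` whose opens are exactly the
`(U_i)_{t_{ik}} = ⋃_b X_{T i k b}`.  (Affineness of the pieces is not needed for this statement; it enters in the
corollaries.) [cite: Hartshorne1977, II Lemma 5.14 (p. 118) and II Thm. 7.6 (p. 159)]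
[cite: GortzWedhorn2020, Prop. 13.47 and Lemma 13.48 (pp. 392–393)]
[cite: MumfordFogartyKirwan1994, Ch. 3 §2 Thm. 3.8 (p. 77)] -/
theorem exists_generatingSections_of_affinePieces :
    ∃ D : GeneratingSections (Σ i, κ i) X, ∀ p, D.U p = ⨆ b, X.basicOpen (T p.1 p.2 b) := by
  classical
  -- (0) Where the coefficients live.
  have hTU : ∀ i k b, X.basicOpen (T i k b) ≤ ⨆ a, X.basicOpen (S.coeff i a) := fun i k b =>
    (X.basicOpen_le _).trans inf_le_right
  have hTW : ∀ i k b, X.basicOpen (T i k b) ≤ W' b := fun i k b => (X.basicOpen_le _).trans inf_le_left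
  have hSW : ∀ i a, X.basicOpen (S.coeff i a) ≤ W a := fun i a => X.basicOpen_le _
  -- (1) The `T`-loci are compatible: `X_{T i k b} ∩ W' b' ⊆ X_{T i k b'}` (from the transition units).
  have hTloc : ∀ i k b b', X.basicOpen (T i k b) ⊓ W' b' ≤ X.basicOpen (T i k b') := by
    intro i k b b'
    have h := CocycleSections.locus_of_cocycle (W := fun b => W' b ⊓ ⨆ a, X.basicOpen (S.coeff i a)) (T i)
      (fun b b' => X.presheaf.map (homOfLE (inf_le_inf inf_le_left inf_le_left :
        (W' b ⊓ ⨆ a, X.basicOpen (S.coeff i a)) ⊓ (W' b' ⊓ ⨆ a, X.basicOpen (S.coeff i a)) ≤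
          W' b ⊓ W' b')).op (g b b'))
      (fun k b b' => hT i k b b') (fun b b' => (hg b b').map _) k b b'
    refine le_trans ?_ h
    exact le_inf inf_le_left (le_inf inf_le_right (inf_le_left.trans (hTU i k b)))
  -- (2) Finite sub-covers of `W` and `W'`.
  have hWtop : ⨆ a, W a = ⊤ := top_le_iff.mp (hcov.ge.trans (iSup_le fun i => iSup_le fun k => iSup_le fun b =>
    (hTU i k b).trans (iSup_le fun a => (hSW i a).trans (le_iSup W a))))
  have hW'top : ⨆ b, W' b = ⊤ := top_le_iff.mp (hcov.ge.trans (iSup_le fun i => iSup_le fun k => iSup_le fun b =>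
    (hTW i k b).trans (le_iSup W' b)))
  obtain ⟨A, hA⟩ := exists_finset_iSup_eq_top W hWtop
  obtain ⟨B, hB⟩ := exists_finset_iSup_eq_top W' hW'top
  have hmemA : ∀ x : X, ∃ a ∈ A, x ∈ W a := fun x => by
    have hx : x ∈ (⨆ a ∈ A, W a) := by rw [hA]; trivial
    simpa only [Opens.mem_iSup, exists_prop] using hx
  have hmemB : ∀ x : X, ∃ b ∈ B, x ∈ W' b := fun x => by
    have hx : x ∈ (⨆ b ∈ B, W' b) := by rw [hB]; trivial
    simpa only [Opens.mem_iSup, exists_prop] using hx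
  -- (3) The charts `V (a, b) = W a ∩ W' b`, the functions `f = S i a` and `x = T i k b` on `X_f ⊆ W' b ∩ U_i`.
  let V : A × B → X.Opens := fun ab => W ab.1.1 ⊓ W' ab.2.1
  let P := (Σ i, κ i) × (A × B)
  let f : ∀ q : P, Γ(X, V q.2) := fun q =>
    X.presheaf.map (homOfLE (inf_le_left : V q.2 ≤ W q.2.1.1)).op (S.coeff q.1.1 q.2.1.1)
  have hfbo : ∀ q : P, X.basicOpen (f q) = V q.2 ⊓ X.basicOpen (S.coeff q.1.1 q.2.1.1) := fun q =>
    Scheme.basicOpen_res _ _ _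
  have hfle : ∀ q : P, X.basicOpen (f q) ≤ W' q.2.2.1 ⊓ ⨆ a, X.basicOpen (S.coeff q.1.1 a) := fun q => by
    rw [hfbo]
    exact inf_le_inf inf_le_right (le_iSup (fun a => X.basicOpen (S.coeff q.1.1 a)) q.2.1.1)
  let x : ∀ q : P, Γ(X, X.basicOpen (f q)) := fun q =>
    X.presheaf.map (homOfLE (hfle q)).op (T q.1.1 q.1.2 q.2.2.1)
  -- (4) Uniform extension: `y = f^n · x` on `X_f`.
  obtain ⟨n, y, hy⟩ := exists_uniform_extension (fun q : P => V q.2) f x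
  -- (5) The non-vanishing locus of `f^e · y` (`0 < e`) is `X_f ∩ X_{T i k b}`.
  have hcbo : ∀ (q : P) {e : ℕ}, 0 < e →
      X.basicOpen (f q ^ e * y q) = X.basicOpen (f q) ⊓ X.basicOpen (T q.1.1 q.1.2 q.2.2.1) := by
    intro q e he
    have hres : X.basicOpen (X.presheaf.map (homOfLE (X.basicOpen_le (f q))).op (y q)) =
        X.basicOpen (f q) ⊓ X.basicOpen (T q.1.1 q.1.2 q.2.2.1) := by
      have hu : IsUnit (X.presheaf.map (homOfLE (X.basicOpen_le (f q))).op (f q) ^ n) :=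
        (RingedSpace.isUnit_res_basicOpen _ (f q)).pow n
      rw [hy q, X.basicOpen_mul, X.basicOpen_of_isUnit hu]
      change X.basicOpen (f q) ⊓ X.basicOpen (X.presheaf.map (homOfLE (hfle q)).op _) = _
      rw [X.basicOpen_res _ (homOfLE (hfle q)).op, ← inf_assoc, inf_idem]
    rw [X.basicOpen_mul, X.basicOpen_pow _ he, ← hres, X.basicOpen_res (y q) (homOfLE (X.basicOpen_le (f q))).op]
  -- (6) Uniform torsion exponent for the cross-compatibilities.
  let Q := P × P
  let V4 : Q → X.Opens := fun θ => V θ.1.2 ⊓ V θ.2.2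
  let sQ : ∀ θ : Q, Γ(X, V4 θ) := fun θ =>
    X.presheaf.map (homOfLE (inf_le_right : V4 θ ≤ V θ.2.2)).op (f (θ.1.1, θ.2.2)) *
      X.presheaf.map (homOfLE (inf_le_left : V4 θ ≤ V θ.1.2)).op (f (θ.2.1, θ.1.2)) *
      (X.presheaf.map (homOfLE (inf_le_right : V4 θ ≤ V θ.2.2)).op (f θ.2) *
        X.presheaf.map (homOfLE (inf_le_left : V4 θ ≤ V θ.1.2)).op (f θ.1))
  let uQ : ∀ θ : Q, Γ(X, V4 θ) := fun θ =>
    X.presheaf.map (homOfLE (inf_le_right : V4 θ ≤ V θ.2.2)).op (y (θ.1.1, θ.2.2)) *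
      X.presheaf.map (homOfLE (inf_le_left : V4 θ ≤ V θ.1.2)).op (y (θ.2.1, θ.1.2))
  let vQ : ∀ θ : Q, Γ(X, V4 θ) := fun θ =>
    X.presheaf.map (homOfLE (inf_le_right : V4 θ ≤ V θ.2.2)).op (y θ.2) *
      X.presheaf.map (homOfLE (inf_le_left : V4 θ ≤ V θ.1.2)).op (y θ.1)
  -- the cross identity of `S` restricted to a small open
  have hScross : ∀ (i j : ι) (a a' : α) {O : X.Opens} (ha : O ≤ W a) (ha' : O ≤ W a'),
      X.presheaf.map (homOfLE ha').op (S.coeff i a') * X.presheaf.map (homOfLE ha).op (S.coeff j a) =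
        X.presheaf.map (homOfLE ha').op (S.coeff j a') * X.presheaf.map (homOfLE ha).op (S.coeff i a) := by
    intro i j a a' O ha ha'
    have h := congr_arg (X.presheaf.map (homOfLE (le_inf ha ha' : O ≤ W a ⊓ W a')).op) (S.cross i j a a')
    simpa only [map_mul, res_res] using h
  -- the transition identity of `T` restricted to a small open
  have hTres : ∀ (i : ι) (k : κ i) (b b' : β) {O : X.Opens}
      (hb : O ≤ W' b ⊓ ⨆ a, X.basicOpen (S.coeff i a)) (hb' : O ≤ W' b' ⊓ ⨆ a, X.basicOpen (S.coeff i a)),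
      X.presheaf.map (homOfLE hb').op (T i k b') =
        X.presheaf.map (homOfLE (le_inf (hb.trans inf_le_left) (hb'.trans inf_le_left))).op (g b b') *
          X.presheaf.map (homOfLE hb).op (T i k b) := by
    intro i k b b' O hb hb'
    have h := congr_arg (X.presheaf.map (homOfLE (le_inf hb hb')).op) (hT i k b b')
    simpa only [map_mul, res_res] using h
  -- `y = f^n · T` restricted to a small open inside `X_f`
  have hyres : ∀ (q : P) {O : X.Opens} (hO : O ≤ X.basicOpen (f q)),
      X.presheaf.map (homOfLE (hO.trans (X.basicOpen_le (f q)))).op (y q) =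
        X.presheaf.map (homOfLE (hO.trans (X.basicOpen_le (f q)))).op (f q) ^ n *
          X.presheaf.map (homOfLE (hO.trans (hfle q))).op (T q.1.1 q.1.2 q.2.2.1) := by
    intro q O hO
    have h := congr_arg (X.presheaf.map (homOfLE hO).op) (hy q)
    simpa only [x, map_mul, map_pow, res_res] using h
  have huv : ∀ θ : Q, X.presheaf.map (homOfLE (X.basicOpen_le (sQ θ))).op (uQ θ) =
      X.presheaf.map (homOfLE (X.basicOpen_le (sQ θ))).op (vQ θ) := by
    intro θ
    -- the small open `O = X_{sQ θ}` lies in the four `X_f`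
    have hO4 : X.basicOpen (sQ θ) ≤ V4 θ := X.basicOpen_le _
    have hbo : ∀ {O' : X.Opens} (h : V4 θ ≤ O') (z : Γ(X, O')),
        X.basicOpen (X.presheaf.map (homOfLE h).op z) ≤ X.basicOpen z := fun h z => by
      rw [Scheme.basicOpen_res]; exact inf_le_right
    have h1 : X.basicOpen (sQ θ) ≤ X.basicOpen (f (θ.1.1, θ.2.2)) := by
      refine (X.basicOpen_mul _ _).le.trans (inf_le_left.trans ((X.basicOpen_mul _ _).le.trans
        (inf_le_left.trans (hbo _ _))))
    have h2 : X.basicOpen (sQ θ) ≤ X.basicOpen (f (θ.2.1, θ.1.2)) := by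
      refine (X.basicOpen_mul _ _).le.trans (inf_le_left.trans ((X.basicOpen_mul _ _).le.trans
        (inf_le_right.trans (hbo _ _))))
    have h3 : X.basicOpen (sQ θ) ≤ X.basicOpen (f θ.2) := by
      refine (X.basicOpen_mul _ _).le.trans (inf_le_right.trans ((X.basicOpen_mul _ _).le.trans
        (inf_le_left.trans (hbo _ _))))
    have h4 : X.basicOpen (sQ θ) ≤ X.basicOpen (f θ.1) := by
      refine (X.basicOpen_mul _ _).le.trans (inf_le_right.trans ((X.basicOpen_mul _ _).le.trans
        (inf_le_right.trans (hbo _ _))))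
    have e1 := hyres (θ.1.1, θ.2.2) h1
    have e2 := hyres (θ.2.1, θ.1.2) h2
    have e3 := hyres θ.2 h3
    have e4 := hyres θ.1 h4
    -- `T … b' = g · T … b` for the two sections, on `O`
    have t1 := hTres θ.1.1.1 θ.1.1.2 θ.1.2.2.1 θ.2.2.2.1 (h4.trans (hfle θ.1)) (h1.trans (hfle (θ.1.1, θ.2.2)))
    have t2 := hTres θ.2.1.1 θ.2.1.2 θ.1.2.2.1 θ.2.2.2.1 (h2.trans (hfle (θ.2.1, θ.1.2))) (h3.trans (hfle θ.2))
    -- the cross identity of `S` on `O`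
    have c1 := hScross θ.1.1.1 θ.2.1.1 θ.1.2.1.1 θ.2.2.1.1
      ((hO4.trans inf_le_left).trans inf_le_left) ((hO4.trans inf_le_right).trans inf_le_left)
    simp only [uQ, vQ, map_mul, res_res]
    rw [e1, e2, e3, e4, t1, t2]
    simp only [f, res_res]
    exact cross_algebra c1
  obtain ⟨N, hN⟩ := exists_uniform_pow_mul_eq V4 sQ uQ vQ huv
  -- (7) The coefficients `f^(2N+1) · y` form cocycle-sections data on the cover `V`.
  have he : 0 < 2 * N + 1 := Nat.succ_pos _
  let U : CocycleSections (Σ i, κ i) V :=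
    { coeff := fun p ab => f (p, ab) ^ (2 * N + 1) * y (p, ab)
      cross := by
        intro p p' ab ab'
        have h := hN ((p, ab), (p', ab'))
        have c1 := hScross p.1 p'.1 ab.1.1 ab'.1.1
          ((inf_le_left : V ab ⊓ V ab' ≤ V ab).trans inf_le_left)
          ((inf_le_right : V ab ⊓ V ab' ≤ V ab').trans inf_le_left)
        simp only [sQ, uQ, vQ, f, map_mul, map_pow, res_res] at h c1 ⊢
        exact cross_of_torsion c1 h
      locus := by
        intro p ab ab'
        rw [hcbo (p, ab) he, hcbo (p, ab') he, hfbo, hfbo]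
        refine le_inf (le_inf inf_le_right ?_) ?_
        · refine le_trans ?_ (S.locus p.1 ab.1.1 ab'.1.1)
          exact le_inf (inf_le_left.trans (inf_le_left.trans inf_le_right)) (inf_le_right.trans inf_le_left)
        · exact le_trans (le_inf (inf_le_left.trans inf_le_right) (inf_le_right.trans inf_le_right))
            (hTloc p.1 p.2 ab.2.1 ab'.2.1) }
  -- (8) Their non-vanishing loci cover `X`.
  have hmem : ∀ (i : ι) (k : κ i) (b₀ : β) (z : X), z ∈ X.basicOpen (T i k b₀) →
      ∃ ab : A × B, z ∈ X.basicOpen (U.coeff ⟨i, k⟩ ab) := by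
    intro i k b₀ z hz
    obtain ⟨a, haA, ha⟩ := hmemA z
    obtain ⟨b, hbB, hb⟩ := hmemB z
    have hzU : z ∈ (⨆ a, X.basicOpen (S.coeff i a)) := hTU i k b₀ hz
    obtain ⟨a₀, ha₀⟩ := Opens.mem_iSup.mp hzU
    have hza : z ∈ X.basicOpen (S.coeff i a) := S.locus i a₀ a ⟨ha₀, ha⟩
    have hzb : z ∈ X.basicOpen (T i k b) := hTloc i k b₀ b ⟨hz, hb⟩
    refine ⟨(⟨a, haA⟩, ⟨b, hbB⟩), ?_⟩
    change z ∈ X.basicOpen (f (⟨i, k⟩, (⟨a, haA⟩, ⟨b, hbB⟩)) ^ (2 * N + 1) * y (⟨i, k⟩, (⟨a, haA⟩, ⟨b, hbB⟩)))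
    rw [hcbo _ he, hfbo]
    exact ⟨⟨⟨ha, hb⟩, hza⟩, hzb⟩
  have hcov' : ⨆ p, ⨆ ab, X.basicOpen (U.coeff p ab) = ⊤ := by
    refine top_le_iff.mp fun z _ => ?_
    have hz : z ∈ (⨆ i, ⨆ k, ⨆ b, X.basicOpen (T i k b)) := by rw [hcov]; trivial
    simp only [Opens.mem_iSup] at hz
    obtain ⟨i, k, b₀, hz⟩ := hz
    obtain ⟨ab, hab⟩ := hmem i k b₀ z hz
    exact Opens.mem_iSup.mpr ⟨⟨i, k⟩, Opens.mem_iSup.mpr ⟨ab, hab⟩⟩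
  -- (9) The generating sections and their opens.
  refine ⟨ofCocycleSections V U hcov', fun p => ?_⟩
  rw [ofCocycleSections_U]
  refine le_antisymm (iSup_le fun ab => ?_) (iSup_le fun b₀ => ?_)
  · change X.basicOpen (f (p, ab) ^ (2 * N + 1) * y (p, ab)) ≤ _
    rw [hcbo _ he]
    exact inf_le_right.trans (le_iSup (fun b => X.basicOpen (T p.1 p.2 b)) ab.2.1)
  · intro z hz
    obtain ⟨ab, hab⟩ := hmem p.1 p.2 b₀ z hz
    exact Opens.mem_iSup.mpr ⟨ab, hab⟩

include hg hT hcov haff in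
/-- **Locally ample pieces give generating sections with AFFINE non-vanishing loci** (Görtz–Wedhorn I, Prop. 13.47
(iv): «`𝓛` is generated by finitely many global sections with affine non-vanishing loci» — here for `𝓝 ⊗ 𝓛^{⊗n}` and
the sections `t_{ik} · s_i^n`, whose loci are the given affine pieces `(U_i)_{t_{ik}}`).
[cite: GortzWedhorn2020, Prop. 13.47 (pp. 392–393)] [cite: Hartshorne1977, II Lemma 5.14 (p. 118)] -/
theorem exists_generatingSections_isAffineOpen_of_affinePieces :
    ∃ D : GeneratingSections (Σ i, κ i) X, ∀ p, IsAffineOpen (D.U p) := by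
  obtain ⟨D, hD⟩ := exists_generatingSections_of_affinePieces W' S g hg T hT hcov
  exact ⟨D, fun p => (hD p).symm ▸ haff p.1 p.2⟩

end Main

/-! ### Over a field: quasi-projectivity -/

/-- **A Noetherian `k`-scheme locally of finite type covered by locally ample affine pieces is quasi-projective**
(EGA II Thm. 4.5.2 with Görtz–Wedhorn I, Prop. 13.47 and Thm. 13.59: the line bundle «`𝓝 ⊗ 𝓛^{⊗n}`» is generated by
finitely many global sections with affine non-vanishing loci, hence ample, hence `Z` is quasi-projective — in chart
form via ★ `GeneratingSections.isQuasiProjectiveOver_of_isAffineOpen`).  Data as in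
`exists_generatingSections_of_affinePieces`: coefficients `S` of the sections of `𝓛`, transition units `g` of `𝓝`
on the cover `W'`, coefficients `T i k` of sections of `𝓝` over `U_i = ⋃_a X_{S i a}` with AFFINE loci covering `Z`.
[cite: GortzWedhorn2020, Prop. 13.47 (pp. 392–393) and Thm. 13.59 (p. 398)] [cite: Hartshorne1977, II Thm. 7.6 (p. 159)] -/
theorem isQuasiProjectiveOver_of_affinePieces {k : Type u} [Field k] {Z : SchemeOver k} [IsNoetherian Z.left]
    [LocallyOfFiniteType Z.hom] {α : Type v} {β : Type w} {W : α → Z.left.Opens} (W' : β → Z.left.Opens)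
    {ι : Type} [Finite ι] (S : CocycleSections ι W)
    (g : (b b' : β) → Γ(Z.left, W' b ⊓ W' b')) (hg : ∀ b b', IsUnit (g b b'))
    {κ : ι → Type} [∀ i, Finite (κ i)]
    (T : ∀ i, κ i → ∀ b : β, Γ(Z.left, W' b ⊓ ⨆ a, Z.left.basicOpen (S.coeff i a)))
    (hT : ∀ i (k : κ i) (b b' : β),
      Z.left.presheaf.map (homOfLE (inf_le_right :
          (W' b ⊓ ⨆ a, Z.left.basicOpen (S.coeff i a)) ⊓ (W' b' ⊓ ⨆ a, Z.left.basicOpen (S.coeff i a)) ≤ _)).op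
          (T i k b') =
        Z.left.presheaf.map (homOfLE (inf_le_inf inf_le_left inf_le_left :
          (W' b ⊓ ⨆ a, Z.left.basicOpen (S.coeff i a)) ⊓ (W' b' ⊓ ⨆ a, Z.left.basicOpen (S.coeff i a)) ≤
            W' b ⊓ W' b')).op (g b b') *
        Z.left.presheaf.map (homOfLE (inf_le_left :
          (W' b ⊓ ⨆ a, Z.left.basicOpen (S.coeff i a)) ⊓ (W' b' ⊓ ⨆ a, Z.left.basicOpen (S.coeff i a)) ≤ _)).op
          (T i k b))
    (haff : ∀ i k, IsAffineOpen (⨆ b, Z.left.basicOpen (T i k b)))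
    (hcov : ⨆ i, ⨆ k, ⨆ b, Z.left.basicOpen (T i k b) = ⊤) :
    IsQuasiProjectiveOver Z := by
  obtain ⟨D, hD⟩ := exists_generatingSections_isAffineOpen_of_affinePieces W' S g hg T hT haff hcov
  haveI : Finite (Σ i, κ i) := inferInstance
  exact isQuasiProjectiveOver_of_isAffineOpen D hD

end CocycleSections

end GeneratingSections

end Literature.AlgebraicGeometry.Motives
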